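import Literature.AlgebraicGeometry.Morphisms.ProjectiveSpaceOverAffine
import Literature.AlgebraicGeometry.Morphisms.CechH1Projective
import Mathlib.AlgebraicGeometry.Morphisms.ClosedImmersion
import Literature.AlgebraicGeometry.Motives.FlatFamilyFibreTwists
import Literature.AlgebraicGeometry.Motives.FlatFamilyGrassmannianPoint
import Literature.AlgebraicGeometry.Modules.SerreTwistMonomialSections
import Literature.AlgebraicGeometry.Modules.CohomologyFlatBaseChange
import Literature.AlgebraicGeometry.Morphisms.SectionsRankOfFibreVanishing
import Literature.AlgebraicGeometry.Modules.PullbackUnitSectionCoherence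
import Literature.AlgebraicGeometry.HodgeTheory.ProjectiveMumfordRegularityBound
import Mathlib.LinearAlgebra.Finsupp.VectorSpace
import Mathlib.RingTheory.Localization.FractionRing
import HarnessLib

/-!
# Flat families in `𝐏(ι; T)` with given Hilbert polynomial: the `T`-point of the Grassmannian (Mumford, *Curves on an
# algebraic surface*, Lecture 15 (II.); MFK Prop. 0.10) — edition 1: the fibres as closed subschemes of `𝐏ⁿ_K`

Layer `Literature/AlgebraicGeometry/Motives`, namespace `Literature.AlgebraicGeometry.Motives`; THEOREMS ONLY (no `def`, no
named fact, no `sorry`).  Cell `hodgecm-mathlib` (D-0151), F-5 (5d-I) FILE γ (director s232/s237; B-plan1 (g17) 10:00:53Z path of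
record; author B-p19 (g16), sockets `B-provers/B-p19/g16/FlatFamilyHilbertPolynomialGrassmannianPoint.SOCKETS.B-p19g16.lean`).

THE FILE'S TARGET (appended in later editions, see the SOCKETS): for a flat closed family `i : Z ⊂ 𝐏(ι; T)` over a locally
Noetherian `T` whose direct images `(p_Z)_* 𝒪_Z(e)` are locally free of rank `P(e)` for `e ≫ 0`, and `d ≥ B(P) - 1` (Mumford's
bound), the monomial sections `μ_w|_Z ∈ Γ(Z, 𝒪_Z(d))` (★ `SerreTwist.monomialSection`) define a unique `T`-point of the Grassmannian
of rank-`P(d)` quotients of `ℤ^{(Mon_d)}` (★ β `existsUnique_hom_grassmannian_of_forall_fieldPoint`, whose fibrewise binders are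
discharged through ★ L-a `ProjectiveFibreHilbertPolynomialTwists` on the fibres and ★ (γ1) `SerreTwist.exists_pullback_twistMod_iso_of_sq`).

EDITION 1 (§1, this file so far): **the fibre of the family over a field point sits in its own projective space.**  For a
cartesian square `X₀ = Z ×_T Spec K` over `x : Spec K → T` there is a closed immersion `ιK : X₀ → 𝐏ⁿ_K = Proj K[x₀, …, xₙ]` over
`K` with `k ≫ i ≫ pr₂ = ιK ≫ Proj (ℤ[x] → K[x])` (`exists_closedImmersion_fibre`) — exactly the square `w` of ★
`SerreTwist.exists_pullback_twistMod_iso_of_sq`, so that `k^* 𝒪_Z(e) ≅ 𝒪_{X₀}(e) := twistMod ιK 𝒪 e` with monomials pulled back to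
monomials; it rests on `𝐏ⁿ_K = 𝐏(ι; T) ×_T Spec K` (`isPullback_projectiveSpace_fieldPoint`, ★ `isPullback_projToSpec_projMap_terminal`
pasted with `𝐏(ι; T) = T × 𝐏ⁿ_ℤ`) and on the stability of closed immersions under base change (Mathlib).

Count-neutral capital (`--supports stmt-HodgeConjecture-24835`); HC_CM is proved only modulo the 7 printed citations until rung 0
closes, and this file discharges none of them.

## References
* [Mumford1966CurvesSurface] D. Mumford, *Lectures on Curves on an Algebraic Surface* (1966), Lecture 15 (II.).
* [Hartshorne1977] R. Hartshorne, *Algebraic Geometry* (1977), II Ex. 3.10 (fibres), II §4 (`𝐏ⁿ_Y := 𝐏ⁿ_ℤ × Y`, p. 103), III Cor. 9.4.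
* [GortzWedhorn2020] U. Görtz, T. Wedhorn, *Algebraic Geometry I* (2nd ed., 2020), Section (4.12) (p. 113).
-/

noncomputable section

-- `TopCat.Presheaf`/`Scheme.Modules` are not reducible (as in Mathlib's `AlgebraicGeometry/Modules/Sheaf.lean`).
set_option backward.isDefEq.respectTransparency false

open CategoryTheory CategoryTheory.Limits AlgebraicGeometry TopologicalSpace Opposite

namespace Literature.AlgebraicGeometry.Motives

open Literature.AlgebraicGeometry.Morphisms Literature.AlgebraicGeometry.Morphisms.ProjCech

attribute [local instance] MvPolynomial.gradedAlgebra

/-! ### §1 The fibre over a field point as a closed subscheme of `𝐏ⁿ_K` -/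

universe u

variable {ι : Type u} {T Z : Scheme.{u}} (i : Z ⟶ Morphisms.projectiveSpace ι T) [IsClosedImmersion i]
  {K : Type u} [CommRing K] [Algebra intU.{u} K] {X₀ : Scheme.{u}} {k : X₀ ⟶ Z} {f₀ : X₀ ⟶ Spec (.of K)}
  {x : Spec (.of K) ⟶ T} (H : IsPullback k f₀ (i ≫ Morphisms.projectiveSpaceFst ι T) x)

/-- **`𝐏ⁿ_K = 𝐏(ι; T) ×_T Spec K`** for a `K`-point `x : Spec K → T`: the square with top the morphism
`𝐏ⁿ_K → 𝐏(ι; T)` of components `(𝐏ⁿ_K → Spec K → T, Proj (ℤ[x] → K[x]))` is cartesian (★ `isPullback_projToSpec_projMap_terminal`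
pasted with `𝐏(ι; T) = T × 𝐏ⁿ_ℤ`). [cite: GortzWedhorn2020, Section (4.12) (p. 113)] -/
theorem isPullback_projectiveSpace_fieldPoint (x : Spec (.of K) ⟶ T) :
    IsPullback
      (pullback.lift (ProjBaseChangeRing.projToSpec (Fin (Nat.card ι + 1)) K ≫ x)
        (Proj.map (ProjBaseChangeRing.mapGraded intU.{u} K (Fin (Nat.card ι + 1)))
          (ProjBaseChangeRing.irrelevant_le_map intU.{u} K (Fin (Nat.card ι + 1))))
        (by simp only [Category.assoc]; exact terminal.hom_ext _ _) :
          PP K (Nat.card ι) ⟶ Morphisms.projectiveSpace ι T)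
      (ProjBaseChangeRing.projToSpec (Fin (Nat.card ι + 1)) K) (Morphisms.projectiveSpaceFst ι T) x := by
  refine IsPullback.of_right (h₁₂ := pullback.snd (terminal.from T) (terminal.from (Morphisms.projectiveSpaceInt ι)))
    (v₁₃ := terminal.from (Morphisms.projectiveSpaceInt ι)) (h₂₂ := terminal.from T) ?_ (pullback.lift_fst _ _ _) ?_
  · rw [pullback.lift_snd, terminal.comp_from]
    exact (Morphisms.isPullback_projToSpec_projMap_terminal ι K).flip
  · exact (IsPullback.of_hasPullback (terminal.from T) (terminal.from (Morphisms.projectiveSpaceInt ι))).flip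

include H in
/-- **The fibre over a field point embeds in `𝐏ⁿ_K`.**  For a closed family `i : Z ⊂ 𝐏(ι; T)` and a cartesian square
`X₀ = Z ×_T Spec K` over `x : Spec K → T`, there is a closed immersion `ιK : X₀ → 𝐏ⁿ_K` over `K` with
`k ≫ i ≫ pr₂ = ιK ≫ Proj (ℤ[x] → K[x])` — the square to which ★ `SerreTwist.exists_pullback_twistMod_iso_of_sq` applies.
[cite: Hartshorne1977, II Ex. 3.10 and III Cor. 9.4] -/
theorem exists_closedImmersion_fibre :
    ∃ ιK : X₀ ⟶ PP K (Nat.card ι), IsClosedImmersion ιK ∧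
      ιK ≫ ProjBaseChangeRing.projToSpec (Fin (Nat.card ι + 1)) K = f₀ ∧
      k ≫ (i ≫ pullback.snd (terminal.from T) (terminal.from (Morphisms.projectiveSpaceInt ι))) =
        ιK ≫ Proj.map (ProjBaseChangeRing.mapGraded intU.{u} K (Fin (Nat.card ι + 1)))
          (ProjBaseChangeRing.irrelevant_le_map intU.{u} K (Fin (Nat.card ι + 1))) := by
  have hP := Morphisms.isPullback_projToSpec_projMap_terminal ι K
  -- the lift `ιK = (f₀, k ≫ i ≫ pr₂)`
  let ιK : X₀ ⟶ PP K (Nat.card ι) :=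
    hP.lift f₀ (k ≫ i ≫ pullback.snd (terminal.from T) (terminal.from (Morphisms.projectiveSpaceInt ι)))
      (terminal.hom_ext _ _)
  have h1 : ιK ≫ ProjBaseChangeRing.projToSpec (Fin (Nat.card ι + 1)) K = f₀ := hP.lift_fst _ _ _
  have h2 : ιK ≫ Proj.map (ProjBaseChangeRing.mapGraded intU.{u} K (Fin (Nat.card ι + 1)))
      (ProjBaseChangeRing.irrelevant_le_map intU.{u} K (Fin (Nat.card ι + 1))) =
      k ≫ i ≫ pullback.snd (terminal.from T) (terminal.from (Morphisms.projectiveSpaceInt ι)) := hP.lift_snd _ _ _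
  have hC := isPullback_projectiveSpace_fieldPoint (ι := ι) (T := T) (K := K) x
  -- the square `k ≫ i = ιK ≫ j`
  have hsq : k ≫ i = ιK ≫ pullback.lift (ProjBaseChangeRing.projToSpec (Fin (Nat.card ι + 1)) K ≫ x)
      (Proj.map (ProjBaseChangeRing.mapGraded intU.{u} K (Fin (Nat.card ι + 1)))
        (ProjBaseChangeRing.irrelevant_le_map intU.{u} K (Fin (Nat.card ι + 1))))
      (by simp only [Category.assoc]; exact terminal.hom_ext _ _) := by
    apply pullback.hom_ext
    · rw [Category.assoc, Category.assoc, pullback.lift_fst,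
        ← Category.assoc ιK (ProjBaseChangeRing.projToSpec (Fin (Nat.card ι + 1)) K) x, h1]
      exact H.w
    · rw [Category.assoc, Category.assoc, pullback.lift_snd, h2]
  have hD : IsPullback k ιK i _ := IsPullback.of_bot (by rw [h1]; exact H) hsq hC
  exact ⟨ιK, IsClosedImmersion.isStableUnderBaseChange.of_isPullback hD inferInstance, h1, by rw [h2]⟩

end Literature.AlgebraicGeometry.Motives

/-! ## Edition 2 (§5–§6): descent of the fibre letters along a field extension, and the `T`-point of the Grassmannian

EDITION 2 appends: **§5** the descent of a spanning family of global sections along a field extension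
(`secMod_mk_mem_span_of_isPullback_specMap`: if the pulled-back sections span after the faithfully flat base change
`Spec L → Spec K`, they span before — ★ `Modules/ModuleSectionsFlatBaseChange` + Mathlib `Module.FaithfullyFlat`), and **§6**
the head `existsUnique_hom_grassmannian_of_hasRank_twists`: the three fibre letters of ★ β
(`Motives/FlatFamilyGrassmannianPoint.existsUnique_hom_grassmannian_of_forall_fieldPoint`: `Ext¹ = 0`, `h⁰ = P(d)`, monomials
span) are supplied at every field point `x : Spec K → T` by presenting the base-changed fibre over the INFINITE field
`L = Frac K[t]` in `𝐏ⁿ_L` (§1), reading them there (★ ③a `Motives/FlatFamilyFibreTwists`, Mumford's uniform regularity on a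
presented fibre) and descending to `K` (★ `Modules/CohomologyFlatBaseChange` §4 for `Ext¹`/`h⁰`, §5 for the span).
Cell `hodgecm-mathlib` F-5 slot ③b (B-plan1 (g17) 10:28:54Z; author B-p19 (g17); sockets with ③a B-p01 (g14) 10:57:08Z).

References (ed. 2): [Mumford1966CurvesSurface] Lecture 15 (II.); [GortzWedhorn2020] (8.4) (pp. 213–215) (Grassmannian functor);
[GortzWedhorn2023] Cor. 22.91 (p. 277) (cohomology and flat base change along a field extension); [StacksProject] Tag 02KH. -/

namespace Literature.AlgebraicGeometry.Motives

open CategoryTheory.Abelian TensorProduct Polynomial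
open Literature.AlgebraicGeometry.Modules Literature.AlgebraicGeometry.Motives.Grassmannian
  Literature.AlgebraicGeometry.Morphisms Literature.AlgebraicGeometry.Morphisms.ProjCech
  Literature.Algebra.Homology Literature.Algebra.Homology.LaurentCech

attribute [local instance] MvPolynomial.gradedAlgebra

/-! ### §5 Descent of the span letter along a field extension (the `Ext¹` and `h⁰` letters descend by ★
`CohomologyFlatBaseChange` §4) -/

section Descent

variable {K L : Type} [Field K] [Field L] (φ : K →+* L)
  {X X' : Scheme.{0}} {g : X ⟶ Spec (.of K)} {g' : X' ⟶ Spec (.of L)} {k : X' ⟶ X}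
  (H : IsPullback k g' g (Spec.map (CommRingCat.ofHom φ))) (G : X.Modules)

/-- A homomorphism of fields is faithfully flat, read on `(Spec φ)♯ : Γ(Spec K, 𝒪) → Γ(Spec L, 𝒪)` (= `ΓSpecIso⁻¹ ∘ φ ∘ ΓSpecIso`).
[folklore] -/
private theorem faithfullyFlat_appLE_specMap' :
    ((Spec.map (CommRingCat.ofHom φ)).appLE ⊤ ⊤ le_top).hom.FaithfullyFlat := by
  have hφ : φ.FaithfullyFlat := by
    letI := φ.toAlgebra
    exact RingHom.faithfullyFlat_algebraMap_iff.mpr (inferInstance : Module.FaithfullyFlat K L)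
  have happ : ((Spec.map (CommRingCat.ofHom φ)).appLE ⊤ ⊤ le_top).hom =
      ((Scheme.ΓSpecIso (.of L)).inv.hom.comp φ).comp (Scheme.ΓSpecIso (.of K)).hom.hom := by
    have h0 : (Spec.map (CommRingCat.ofHom φ)).appLE ⊤ ⊤ le_top = (Spec.map (CommRingCat.ofHom φ)).appTop := by
      rw [Scheme.Hom.appTop, Scheme.Hom.app_eq_appLE]
      rfl
    rw [h0]
    have h' : (Spec.map (CommRingCat.ofHom φ)).appTop =
        (Scheme.ΓSpecIso (.of K)).hom ≫ CommRingCat.ofHom φ ≫ (Scheme.ΓSpecIso (.of L)).inv := by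
      rw [Scheme.ΓSpecIso_inv_naturality (CommRingCat.ofHom φ), Iso.hom_inv_id_assoc]
    rw [h']
    rfl
  rw [happ]
  have h1 : ((Scheme.ΓSpecIso (.of L)).inv.hom.comp φ).FaithfullyFlat :=
    RingHom.FaithfullyFlat.respectsIso.1 φ (Scheme.ΓSpecIso (.of L)).symm.commRingCatIsoToRingEquiv hφ
  exact RingHom.FaithfullyFlat.respectsIso.2 _ (Scheme.ΓSpecIso (.of K)).commRingCatIsoToRingEquiv h1

include H in
/-- **A spanning family of global sections descends along a field extension.** For `φ : K → L` a homomorphism of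
fields, `g : X → Spec K` proper, `G` an affine-localizing `𝒪_X`-module, a cartesian square `X' = X ×_K Spec L`
(`H : IsPullback k g' g (Spec φ)`) and global sections `q_j ∈ Γ(X, G)`: if the pulled-back sections `η_k(q_j)` span
`Γ(X', k^*G)` over `Γ(Spec L, 𝒪)`, then the `q_j` span `Γ(X, G)` over `Γ(Spec K, 𝒪)` — flat base change of `H⁰`
(`Γ(X', k^*G) = Γ(Spec L) ⊗ Γ(X, G)`, ★ `exists_tensor_secMod_top_linearEquiv_of_flat`) and faithful flatness of `L/K`
(Mathlib `Module.FaithfullyFlat.lTensor_surjective_iff_surjective`).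
[cite: GortzWedhorn2023, Cor. 22.91 (p. 277)] [cite: StacksProject, Tag 02KH] -/
theorem secMod_mk_mem_span_of_isPullback_specMap [IsProper g] (hG : IsAffineLocalizing G) {J : Type}
    (q : J → Γ(G, ⊤))
    (h' : ∀ σ' : Γ((Scheme.Modules.pullback k).obj G, ⊤),
      SecMod.mk (L := (Scheme.Modules.pullback k).obj G) (ρ := g'.appTop.hom) (U := ⊤) σ' ∈
        Submodule.span Γ(Spec (CommRingCat.of L), ⊤) (Set.range fun j ↦
          SecMod.mk (L := (Scheme.Modules.pullback k).obj G) (ρ := g'.appTop.hom) (U := ⊤)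
            (unitSectionLE k G (V := ⊤) (U := ⊤) le_top (q j))))
    (σ : Γ(G, ⊤)) :
    SecMod.mk (L := G) (ρ := g.appTop.hom) (U := ⊤) σ ∈
      Submodule.span Γ(Spec (CommRingCat.of K), ⊤) (Set.range fun j ↦
        SecMod.mk (L := G) (ρ := g.appTop.hom) (U := ⊤) (q j)) := by
  obtain ⟨ι, _, _, U, hcov, hUa⟩ := exists_finite_affine_cover_cechOpen g
  letI := ((Spec.map (CommRingCat.ofHom φ)).appLE ⊤ ⊤ le_top).hom.toAlgebra
  have hff := faithfullyFlat_appLE_specMap' φ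
  haveI : Module.FaithfullyFlat Γ(Spec (CommRingCat.of K), ⊤) Γ(Spec (CommRingCat.of L), ⊤) :=
    RingHom.faithfullyFlat_algebraMap_iff.mp hff
  obtain ⟨E, hE⟩ := exists_tensor_secMod_top_linearEquiv_of_flat H U hcov hUa G hG hff.flat
  -- the span `W` of the `q_j` and its inclusion
  set W : Submodule Γ(Spec (CommRingCat.of K), ⊤) (SecMod G g.appTop.hom ⊤) :=
    Submodule.span Γ(Spec (CommRingCat.of K), ⊤) (Set.range fun j ↦
      SecMod.mk (L := G) (ρ := g.appTop.hom) (U := ⊤) (q j)) with hW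
  -- `E ∘ (L ⊗ W ↪ L ⊗ Γ(X, G))` is onto: its range is an `L`-submodule containing every `η_k(q_j)`
  have hsurj : Function.Surjective (E.toLinearMap ∘ₗ W.subtype.baseChange Γ(Spec (CommRingCat.of L), ⊤)) := by
    rw [← LinearMap.range_eq_top, eq_top_iff]
    rintro τ -
    have hτ := h' (SecMod.val (L := (Scheme.Modules.pullback k).obj G) (ρ := g'.appTop.hom) τ)
    rw [SecMod.mk_val] at hτ
    refine Submodule.span_le.mpr ?_ hτ
    rintro _ ⟨j, rfl⟩
    refine ⟨(1 : Γ(Spec (CommRingCat.of L), ⊤)) ⊗ₜ ⟨SecMod.mk (L := G) (ρ := g.appTop.hom) (U := ⊤) (q j),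
      Submodule.subset_span ⟨j, rfl⟩⟩, ?_⟩
    rw [LinearMap.comp_apply, LinearMap.baseChange_tmul, Submodule.subtype_apply, LinearEquiv.coe_toLinearMap, hE,
      one_smul]
    rfl
  -- hence `L ⊗ W → L ⊗ Γ(X, G)` is onto, so `W = Γ(X, G)` by faithful flatness
  have h1 : Function.Surjective (W.subtype.baseChange Γ(Spec (CommRingCat.of L), ⊤)) := fun z => by
    obtain ⟨y, hy⟩ := hsurj (E z)
    exact ⟨y, E.injective hy⟩
  have h2 : Function.Surjective (W.subtype.lTensor Γ(Spec (CommRingCat.of L), ⊤)) := by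
    intro z
    obtain ⟨y, hy⟩ := h1 z
    exact ⟨y, by rw [← LinearMap.baseChange_eq_ltensor]; exact hy⟩
  have h3 : Function.Surjective W.subtype :=
    (Module.FaithfullyFlat.lTensor_surjective_iff_surjective _ _ W.subtype).mp h2
  have h4 : W = ⊤ := by
    rw [eq_top_iff]
    rintro v -
    obtain ⟨⟨v', hv'⟩, rfl⟩ := h3 v
    exact hv'
  have : SecMod.mk (L := G) (ρ := g.appTop.hom) (U := ⊤) σ ∈ W := by rw [h4]; trivial
  exact this

end Descent

/-! ### §6 The head: the `T`-point of the Grassmannian from `HasRank` of the twists -/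

section Head

/-- Pull-back modules along `k₁ ≫ k` versus `k₁` after `k`: the unit sections correspond (`η_{k₁ ≫ k}(m) ↦ η_{k₁}(η_k(m))`
under Mathlib's `pullbackComp`), global-sections form. [folklore] -/
private theorem pullbackComp_inv_app_unitSectionLE_top {X₀ X₁ Z : Scheme.{0}} (k₁ : X₁ ⟶ X₀) (k : X₀ ⟶ Z) (M : Z.Modules)
    (m : Γ(M, ⊤)) :
    ((Scheme.Modules.pullbackComp k₁ k).inv.app M).app ⊤ (unitSectionLE (k₁ ≫ k) M (V := ⊤) (U := ⊤) le_top m) =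
      unitSectionLE k₁ _ (V := ⊤) (U := ⊤) le_top (unitSectionLE k M (V := ⊤) (U := ⊤) le_top m) := by
  rw [unitSectionLE_le_top, unitSectionLE_le_top, unitSectionLE_le_top]
  exact pullbackComp_inv_app_unitSection k M k₁ ⊤ m

/-- γ HEAD: **a flat closed family `Z ⊂ 𝐏(ι; T)` with `(p_Z)_* 𝒪_Z(e)` locally free of rank `P(e)` for `e ≥ e₀` defines, for
every `d ≥ B(P) - 1`, a unique `T`-point of the Grassmannian of rank-`P(d)` quotients of `ℤ^{(Mon_d)}` through the MONOMIAL
sections** (Mumford, Lect. 15 (II.); MFK Prop. 0.10 step). At a field point `x : Spec K → T` the fibre `X₀` and its base change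
`X₀'` to the infinite field `L = Frac K[t]` are presented in `𝐏ⁿ` (★ §1); the three fibre letters of ★ β hold at the presented
INFINITE point (★ ③a) and descend to `K` (★ `CohomologyFlatBaseChange` §4, §5); ★ β concludes.
[cite: Mumford1966CurvesSurface, Lecture 15 (II.)] [cite: GortzWedhorn2020, (8.4) (pp. 213–215)] [cite: GortzWedhorn2023, Cor. 22.91 (p. 277)] -/
theorem existsUnique_hom_grassmannian_of_hasRank_twists
    {ι : Type} (hn : 1 ≤ Nat.card ι) {T Z : Scheme.{0}} [IsLocallyNoetherian T]
    (i : Z ⟶ Morphisms.projectiveSpace ι T) [IsClosedImmersion i] [Flat (i ≫ Morphisms.projectiveSpaceFst ι T)]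
    (P : ℚ[X]) (e₀ : ℕ) (R : ℕ → ℕ) (hR : ∀ e, e₀ ≤ e → (R e : ℚ) = P.eval (e : ℚ))
    (hrk : ∀ e, e₀ ≤ e → HasRank ((Scheme.Modules.pushforward (i ≫ Morphisms.projectiveSpaceFst ι T)).obj
      (SerreTwist.twistMod (i ≫ pullback.snd (terminal.from T) (terminal.from (Morphisms.projectiveSpaceInt ι)))
        (unitModule Z) e)) (R e))
    (d k : ℕ) (hk : (k : ℚ) = P.eval (d : ℚ))
    (hd : regularityBound (preHilbertPoly ℚ (Nat.card ι) 0) 0 (preHilbertPoly ℚ (Nat.card ι) 0 - P) - 1 ≤ (d : ℤ))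
    [(grassmannianSheaf ((Fin d → Fin (Nat.card ι + 1)) →₀ ℤ) k).obj.IsRepresentable] :
    ∃! g : T ⟶ grassmannianScheme ((Fin d → Fin (Nat.card ι + 1)) →₀ ℤ) k, ∀ V : T.affineOpens,
      (evalAffine V.2 (pointsEquiv ((Fin d → Fin (Nat.card ι + 1)) →₀ ℤ) k T g)).toSubmodule =
        LinearMap.ker (sectionsMap (Finsupp.basisSingleOne : Module.Basis (Fin d → Fin (Nat.card ι + 1)) ℤ _)
          ((Scheme.Modules.pushforward (i ≫ Morphisms.projectiveSpaceFst ι T)).obj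
            (SerreTwist.twistMod (i ≫ pullback.snd (terminal.from T) (terminal.from (Morphisms.projectiveSpaceInt ι)))
              (unitModule Z) d))
          (fun w => SerreTwist.monomialSection
            (i ≫ pullback.snd (terminal.from T) (terminal.from (Morphisms.projectiveSpaceInt ι))) d w) V) := by
  classical
  -- notation
  set G : Z.Modules := SerreTwist.twistMod
    (i ≫ pullback.snd (terminal.from T) (terminal.from (Morphisms.projectiveSpaceInt ι))) (unitModule Z) d with hG
  have hGal : IsAffineLocalizing G := isAffineLocalizing_twistMod_unitModule _ d
  -- the three letters at an ARBITRARY field point, from the presented infinite point `Spec (Frac K[t]) → Spec K → T`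
  have key : ∀ ⦃K : Type⦄ [Field K] ⦃X₀ : Scheme.{0}⦄ (kX : X₀ ⟶ Z) (f₀ : X₀ ⟶ Spec (CommRingCat.of K))
      (x : Spec (CommRingCat.of K) ⟶ T), IsPullback kX f₀ (i ≫ Morphisms.projectiveSpaceFst ι T) x →
      Subsingleton (Ext.{1} (unitModule X₀) ((Scheme.Modules.pullback kX).obj G) 1) ∧
      Module.finrank Γ(Spec (CommRingCat.of K), ⊤) (SecMod ((Scheme.Modules.pullback kX).obj G) f₀.appTop.hom ⊤) = k ∧
      ∀ σ : Γ((Scheme.Modules.pullback kX).obj G, ⊤),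
        SecMod.mk (L := (Scheme.Modules.pullback kX).obj G) (ρ := f₀.appTop.hom) (U := ⊤) σ ∈
          Submodule.span Γ(Spec (CommRingCat.of K), ⊤) (Set.range fun wd : Fin d → Fin (Nat.card ι + 1) ↦
            SecMod.mk (L := (Scheme.Modules.pullback kX).obj G) (ρ := f₀.appTop.hom) (U := ⊤)
              (unitSectionLE kX _ (V := ⊤) (U := ⊤) le_top (SerreTwist.monomialSection
                (i ≫ pullback.snd (terminal.from T) (terminal.from (Morphisms.projectiveSpaceInt ι))) d wd))) := by
    intro K _ X₀ kX f₀ x H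
    -- the infinite field `L = Frac K[t]` and the base-changed fibre `X₁ = X₀ ×_K Spec L`
    let L : Type := FractionRing (Polynomial K)
    haveI : Infinite L := Infinite.of_injective _ (IsFractionRing.injective (Polynomial K) L)
    let ψ : Spec (CommRingCat.of L) ⟶ Spec (CommRingCat.of K) := Spec.map (CommRingCat.ofHom (algebraMap K L))
    let k₁ : pullback f₀ ψ ⟶ X₀ := pullback.fst f₀ ψ
    let f₁ : pullback f₀ ψ ⟶ Spec (CommRingCat.of L) := pullback.snd f₀ ψ
    have H₁ : IsPullback k₁ f₁ f₀ ψ := IsPullback.of_hasPullback f₀ ψ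
    have H' : IsPullback (k₁ ≫ kX) f₁ (i ≫ Morphisms.projectiveSpaceFst ι T) (ψ ≫ x) := H₁.paste_horiz H
    haveI : IsProper f₀ := MorphismProperty.of_isPullback H inferInstance
    -- present `X₁` in `𝐏ⁿ_L` (★ §1) and read the three letters there (★ ③a)
    letI : Algebra intU.{0} L := ULift.algebra' (R := ℤ) (A := L)
    obtain ⟨ιL, _, hf₁, w⟩ := exists_closedImmersion_fibre i H'
    have E1 := subsingleton_ext_one_pullback_twistMod_of_hasRank_twists hn i P e₀ R hR hrk d hd (k₁ ≫ kX) f₁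
      (ψ ≫ x) H' ιL hf₁ w
    have E2 := finrank_secMod_pullback_twistMod_of_hasRank_twists hn i P e₀ R hR hrk d k hk hd (k₁ ≫ kX) f₁
      (ψ ≫ x) H' ιL hf₁ w
    have E3 := secMod_mk_mem_span_monomialSection_of_hasRank_twists hn i P e₀ R hR hrk d hd (k₁ ≫ kX) f₁
      (ψ ≫ x) H' ιL hf₁ w
    -- move them across `k₁^* kX^* G ≅ (k₁ ≫ kX)^* G`
    let Φ := (Scheme.Modules.pullbackComp k₁ kX).app G
    have hGal' : IsAffineLocalizing ((Scheme.Modules.pullback kX).obj G) := IsAffineLocalizing.pullback kX hGal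
    refine ⟨?_, ?_, ?_⟩
    · haveI : Subsingleton (Ext.{1} (unitModule (pullback f₀ ψ))
          ((Scheme.Modules.pullback k₁).obj ((Scheme.Modules.pullback kX).obj G)) 1) :=
        @subsingleton_ext_of_iso _ _ _ _ (unitModule (pullback f₀ ψ)) _ _ Φ 1 E1
      exact (subsingleton_ext_unit_succ_iff_of_isPullback_specMap (algebraMap K L) H₁
        ((Scheme.Modules.pullback kX).obj G) hGal' 0).mp this
    · obtain ⟨Lin, -⟩ := exists_secMod_linearEquiv_of_iso f₁.appTop.hom Φ
      rw [← finrank_secMod_top_eq_of_isPullback_specMap (algebraMap K L) H₁ ((Scheme.Modules.pullback kX).obj G) hGal']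
      exact Lin.finrank_eq.trans E2
    · refine secMod_mk_mem_span_of_isPullback_specMap (algebraMap K L) H₁ ((Scheme.Modules.pullback kX).obj G) hGal'
        (fun wd : Fin d → Fin (Nat.card ι + 1) => unitSectionLE kX _ (V := ⊤) (U := ⊤) le_top
          (SerreTwist.monomialSection
            (i ≫ pullback.snd (terminal.from T) (terminal.from (Morphisms.projectiveSpaceInt ι))) d wd)) ?_
      intro σ'
      -- `σ' = Φ⁻¹ τ` with `τ ∈ Γ((k₁ ≫ kX)^* G)`, and `Φ⁻¹` is linear and sends `η_{k₁ ≫ kX}(μ_w)` to `η_{k₁}(η_{kX}(μ_w))`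
      obtain ⟨Lin, hLin⟩ := exists_secMod_linearEquiv_of_iso f₁.appTop.hom Φ.symm
      have hσ' : SecMod.mk (L := (Scheme.Modules.pullback k₁).obj ((Scheme.Modules.pullback kX).obj G))
          (ρ := f₁.appTop.hom) (U := ⊤) σ' =
          Lin (SecMod.mk (L := (Scheme.Modules.pullback (k₁ ≫ kX)).obj G) (ρ := f₁.appTop.hom) (U := ⊤)
            (Φ.hom.app ⊤ σ')) := by
        apply SecMod.val_injective
        rw [hLin]
        change σ' = (Φ.hom ≫ Φ.symm.hom).app ⊤ σ'
        rw [Iso.symm_hom, Iso.hom_inv_id]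
        rfl
      rw [hσ']
      have hmem := Submodule.mem_map_of_mem (f := Lin.toLinearMap) (E3 (Φ.hom.app ⊤ σ'))
      rw [Submodule.map_span] at hmem
      refine Submodule.span_mono ?_ hmem
      rintro _ ⟨_, ⟨wd, rfl⟩, rfl⟩
      refine ⟨wd, ?_⟩
      apply SecMod.val_injective
      rw [LinearEquiv.coe_toLinearMap, hLin]
      change unitSectionLE k₁ _ (V := ⊤) (U := ⊤) le_top (unitSectionLE kX _ (V := ⊤) (U := ⊤) le_top
          (SerreTwist.monomialSection _ d wd)) =
        ((Scheme.Modules.pullbackComp k₁ kX).app G).inv.app ⊤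
          (unitSectionLE (k₁ ≫ kX) G (V := ⊤) (U := ⊤) le_top (SerreTwist.monomialSection _ d wd))
      rw [Iso.app_inv, pullbackComp_inv_app_unitSectionLE_top]
  exact existsUnique_hom_grassmannian_of_forall_fieldPoint i d k
    (Finsupp.basisSingleOne : Module.Basis (Fin d → Fin (Nat.card ι + 1)) ℤ _)
    (fun w => SerreTwist.monomialSection
      (i ≫ pullback.snd (terminal.from T) (terminal.from (Morphisms.projectiveSpaceInt ι))) d w)
    (fun K _ X₀ kX f₀ x H => (key kX f₀ x H).1) (fun K _ X₀ kX f₀ x H => (key kX f₀ x H).2.1)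
    (fun K _ X₀ kX f₀ x H => (key kX f₀ x H).2.2)

end Head

/-! ## Edition 3 (§7): the descended field-point letters, the rank of `(p_Z)_* 𝒪_Z(d)` and the epimorphism `𝒪_T^{(Mon_d)} ↠ (p_Z)_* 𝒪_Z(d)` as EXPORTS

EDITION 3 appends, for the (II′) final corollary and the Hilbert-scheme assembly (cell `hodgecm-mathlib` F-5, B-plan1 (g18) U15 (P2);
consumer B-p03 (g19)), the three fibre letters of edition 2's head at an ARBITRARY field point as a theorem
(`forall_fieldPoint_letters_of_hasRank_twists`), and their two global consequences: `(p_Z)_* 𝒪_Z(d)` is locally free of rank `P(d)`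
(`hasRank_pushforward_twistMod_of_hasRank_twists`, ★ α) and any `ψ : 𝒪_T^{(Mon_d)} ⟶ (p_Z)_* 𝒪_Z(d)` sending the basis to the
monomial sections is an epimorphism (`epi_of_app_freeSectionOn_eq_monomialSection`, Nakayama for sheaves ★ L-c over the base-change
isomorphism of ★ α, as in ★ β). [Mumford1966CurvesSurface] Lecture 15 (II.); [GortzWedhorn2023] Cor. 22.91 (p. 277). -/

section Exports

variable {ι : Type} (hn : 1 ≤ Nat.card ι) {T Z : Scheme.{0}} [IsLocallyNoetherian T]
  (i : Z ⟶ Morphisms.projectiveSpace ι T) [IsClosedImmersion i] [Flat (i ≫ Morphisms.projectiveSpaceFst ι T)]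
  (P : ℚ[X]) (e₀ : ℕ) (R : ℕ → ℕ) (hR : ∀ e, e₀ ≤ e → (R e : ℚ) = P.eval (e : ℚ))
  (hrk : ∀ e, e₀ ≤ e → HasRank ((Scheme.Modules.pushforward (i ≫ Morphisms.projectiveSpaceFst ι T)).obj
    (SerreTwist.twistMod (i ≫ pullback.snd (terminal.from T) (terminal.from (Morphisms.projectiveSpaceInt ι)))
      (unitModule Z) e)) (R e))
  (d k : ℕ) (hk : (k : ℚ) = P.eval (d : ℚ))
  (hd : regularityBound (preHilbertPoly ℚ (Nat.card ι) 0) 0 (preHilbertPoly ℚ (Nat.card ι) 0 - P) - 1 ≤ (d : ℤ))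

include hn hR hrk hk hd in
/-- **The three fibre letters at an ARBITRARY field point** (no presentation, any residue field): for a flat closed family
`Z ⊂ 𝐏(ι; T)` over a locally Noetherian `T` with `(p_Z)_* 𝒪_Z(e)` locally free of rank `P(e)` (`e ≥ e₀`), `d ≥ B(P) - 1`,
`k = P(d)`, and any cartesian square `X₀ = Z ×_T Spec K` (`kX`, `f₀`): `Ext¹(𝒪_{X₀}, kX^* 𝒪_Z(d)) = 0`,
`dim_K Γ(X₀, kX^* 𝒪_Z(d)) = k`, and the restricted monomial sections `η_{kX}(μ_w|_Z)` span `Γ(X₀, kX^* 𝒪_Z(d))` over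
`Γ(Spec K, 𝒪)` — by presenting the base change of `X₀` to the infinite field `Frac K[t]` (§1), reading the letters there
(★ `Motives/FlatFamilyFibreTwists`) and descending (★ `Modules/CohomologyFlatBaseChange` §4, §5).
[cite: Mumford1966CurvesSurface, Lecture 15 (II.)] [cite: GortzWedhorn2023, Cor. 22.91 (p. 277)] -/
theorem forall_fieldPoint_letters_of_hasRank_twists ⦃K : Type⦄ [Field K] ⦃X₀ : Scheme.{0}⦄ (kX : X₀ ⟶ Z)
    (f₀ : X₀ ⟶ Spec (CommRingCat.of K)) (x : Spec (CommRingCat.of K) ⟶ T)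
    (H : IsPullback kX f₀ (i ≫ Morphisms.projectiveSpaceFst ι T) x) :
    Subsingleton (Ext.{1} (unitModule X₀) ((Scheme.Modules.pullback kX).obj
      (SerreTwist.twistMod (i ≫ pullback.snd (terminal.from T) (terminal.from (Morphisms.projectiveSpaceInt ι)))
        (unitModule Z) d)) 1) ∧
    Module.finrank Γ(Spec (CommRingCat.of K), ⊤) (SecMod ((Scheme.Modules.pullback kX).obj
      (SerreTwist.twistMod (i ≫ pullback.snd (terminal.from T) (terminal.from (Morphisms.projectiveSpaceInt ι)))
        (unitModule Z) d)) f₀.appTop.hom ⊤) = k ∧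
    ∀ σ : Γ((Scheme.Modules.pullback kX).obj
      (SerreTwist.twistMod (i ≫ pullback.snd (terminal.from T) (terminal.from (Morphisms.projectiveSpaceInt ι)))
        (unitModule Z) d), ⊤),
      SecMod.mk (L := (Scheme.Modules.pullback kX).obj
          (SerreTwist.twistMod (i ≫ pullback.snd (terminal.from T) (terminal.from (Morphisms.projectiveSpaceInt ι)))
            (unitModule Z) d)) (ρ := f₀.appTop.hom) (U := ⊤) σ ∈
        Submodule.span Γ(Spec (CommRingCat.of K), ⊤) (Set.range fun wd : Fin d → Fin (Nat.card ι + 1) ↦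
          SecMod.mk (L := (Scheme.Modules.pullback kX).obj
            (SerreTwist.twistMod (i ≫ pullback.snd (terminal.from T) (terminal.from (Morphisms.projectiveSpaceInt ι)))
              (unitModule Z) d)) (ρ := f₀.appTop.hom) (U := ⊤)
            (unitSectionLE kX _ (V := ⊤) (U := ⊤) le_top (SerreTwist.monomialSection
              (i ≫ pullback.snd (terminal.from T) (terminal.from (Morphisms.projectiveSpaceInt ι))) d wd))) := by
  -- notation
  set G : Z.Modules := SerreTwist.twistMod
    (i ≫ pullback.snd (terminal.from T) (terminal.from (Morphisms.projectiveSpaceInt ι))) (unitModule Z) d with hG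
  have hGal : IsAffineLocalizing G := isAffineLocalizing_twistMod_unitModule _ d
  -- the infinite field `L = Frac K[t]` and the base-changed fibre `X₁ = X₀ ×_K Spec L`
  let L : Type := FractionRing (Polynomial K)
  haveI : Infinite L := Infinite.of_injective _ (IsFractionRing.injective (Polynomial K) L)
  let ψ : Spec (CommRingCat.of L) ⟶ Spec (CommRingCat.of K) := Spec.map (CommRingCat.ofHom (algebraMap K L))
  let k₁ : pullback f₀ ψ ⟶ X₀ := pullback.fst f₀ ψ
  let f₁ : pullback f₀ ψ ⟶ Spec (CommRingCat.of L) := pullback.snd f₀ ψ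
  have H₁ : IsPullback k₁ f₁ f₀ ψ := IsPullback.of_hasPullback f₀ ψ
  have H' : IsPullback (k₁ ≫ kX) f₁ (i ≫ Morphisms.projectiveSpaceFst ι T) (ψ ≫ x) := H₁.paste_horiz H
  haveI : IsProper f₀ := MorphismProperty.of_isPullback H inferInstance
  -- present `X₁` in `𝐏ⁿ_L` (§1) and read the three letters there (★ ③a)
  letI : Algebra intU.{0} L := ULift.algebra' (R := ℤ) (A := L)
  obtain ⟨ιL, _, hf₁, w⟩ := exists_closedImmersion_fibre i H'
  have E1 := subsingleton_ext_one_pullback_twistMod_of_hasRank_twists hn i P e₀ R hR hrk d hd (k₁ ≫ kX) f₁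
    (ψ ≫ x) H' ιL hf₁ w
  have E2 := finrank_secMod_pullback_twistMod_of_hasRank_twists hn i P e₀ R hR hrk d k hk hd (k₁ ≫ kX) f₁
    (ψ ≫ x) H' ιL hf₁ w
  have E3 := secMod_mk_mem_span_monomialSection_of_hasRank_twists hn i P e₀ R hR hrk d hd (k₁ ≫ kX) f₁
    (ψ ≫ x) H' ιL hf₁ w
  -- move them across `k₁^* kX^* G ≅ (k₁ ≫ kX)^* G` and descend along `K → L`
  let Φ := (Scheme.Modules.pullbackComp k₁ kX).app G
  have hGal' : IsAffineLocalizing ((Scheme.Modules.pullback kX).obj G) := IsAffineLocalizing.pullback kX hGal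
  refine ⟨?_, ?_, ?_⟩
  · haveI : Subsingleton (Ext.{1} (unitModule (pullback f₀ ψ))
        ((Scheme.Modules.pullback k₁).obj ((Scheme.Modules.pullback kX).obj G)) 1) :=
      @subsingleton_ext_of_iso _ _ _ _ (unitModule (pullback f₀ ψ)) _ _ Φ 1 E1
    exact (subsingleton_ext_unit_succ_iff_of_isPullback_specMap (algebraMap K L) H₁
      ((Scheme.Modules.pullback kX).obj G) hGal' 0).mp this
  · obtain ⟨Lin, -⟩ := exists_secMod_linearEquiv_of_iso f₁.appTop.hom Φ
    rw [← finrank_secMod_top_eq_of_isPullback_specMap (algebraMap K L) H₁ ((Scheme.Modules.pullback kX).obj G) hGal']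
    exact Lin.finrank_eq.trans E2
  · refine secMod_mk_mem_span_of_isPullback_specMap (algebraMap K L) H₁ ((Scheme.Modules.pullback kX).obj G) hGal'
      (fun wd : Fin d → Fin (Nat.card ι + 1) => unitSectionLE kX _ (V := ⊤) (U := ⊤) le_top
        (SerreTwist.monomialSection
          (i ≫ pullback.snd (terminal.from T) (terminal.from (Morphisms.projectiveSpaceInt ι))) d wd)) ?_
    intro σ'
    obtain ⟨Lin, hLin⟩ := exists_secMod_linearEquiv_of_iso f₁.appTop.hom Φ.symm
    have hσ' : SecMod.mk (L := (Scheme.Modules.pullback k₁).obj ((Scheme.Modules.pullback kX).obj G))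
        (ρ := f₁.appTop.hom) (U := ⊤) σ' =
        Lin (SecMod.mk (L := (Scheme.Modules.pullback (k₁ ≫ kX)).obj G) (ρ := f₁.appTop.hom) (U := ⊤)
          (Φ.hom.app ⊤ σ')) := by
      apply SecMod.val_injective
      rw [hLin]
      change σ' = (Φ.hom ≫ Φ.symm.hom).app ⊤ σ'
      rw [Iso.symm_hom, Iso.hom_inv_id]
      rfl
    rw [hσ']
    have hmem := Submodule.mem_map_of_mem (f := Lin.toLinearMap) (E3 (Φ.hom.app ⊤ σ'))
    rw [Submodule.map_span] at hmem
    refine Submodule.span_mono ?_ hmem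
    rintro _ ⟨_, ⟨wd, rfl⟩, rfl⟩
    refine ⟨wd, ?_⟩
    apply SecMod.val_injective
    rw [LinearEquiv.coe_toLinearMap, hLin]
    change unitSectionLE k₁ _ (V := ⊤) (U := ⊤) le_top (unitSectionLE kX _ (V := ⊤) (U := ⊤) le_top
        (SerreTwist.monomialSection _ d wd)) =
      ((Scheme.Modules.pullbackComp k₁ kX).app G).inv.app ⊤
        (unitSectionLE (k₁ ≫ kX) G (V := ⊤) (U := ⊤) le_top (SerreTwist.monomialSection _ d wd))
    rw [Iso.app_inv, pullbackComp_inv_app_unitSectionLE_top]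

include hn hR hrk hk hd in
/-- **`(p_Z)_* 𝒪_Z(d)` is locally free of rank `k = P(d)` for `d ≥ B(P) - 1`** (not only for `d ≥ e₀`): cohomology and base
change from the fibre letters `Ext¹ = 0` and `h⁰ = k` at every field point (★ α
`hasRank_pushforward_twistMod_of_forall_fieldPoint`). [cite: Mumford1966CurvesSurface, Lecture 15 (II.)]
[cite: Hartshorne1977, III Thm. 12.11 (p. 290), Cor. 12.9 (p. 288)] -/
theorem hasRank_pushforward_twistMod_of_hasRank_twists :
    HasRank ((Scheme.Modules.pushforward (i ≫ Morphisms.projectiveSpaceFst ι T)).obj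
      (SerreTwist.twistMod (i ≫ pullback.snd (terminal.from T) (terminal.from (Morphisms.projectiveSpaceInt ι)))
        (unitModule Z) d)) k :=
  hasRank_pushforward_twistMod_of_forall_fieldPoint i d k
    (fun _ _ _ kX f₀ x H => (forall_fieldPoint_letters_of_hasRank_twists hn i P e₀ R hR hrk d k hk hd kX f₀ x H).1)
    (fun _ _ _ kX f₀ x H => (forall_fieldPoint_letters_of_hasRank_twists hn i P e₀ R hR hrk d k hk hd kX f₀ x H).2.1)

include hn hR hrk hk hd in
/-- **`ψ : 𝒪_T^{(Mon_d)} ⟶ (p_Z)_* 𝒪_Z(d)`, `ε_w ↦ μ_w|_Z`, is an EPIMORPHISM for `d ≥ B(P) - 1`** (the `[Epi ψ]` letter of the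
(II′) assembly): at every field point the base-change ISOMORPHISM of ★ α carries `x^*ψ` onto a map whose image contains the
restricted monomial sections, which span (the third fibre letter), so `x^*ψ` is onto on global sections
(★ β `pullback_map_app_top_surjective_of_span`); Nakayama for sheaves (★ L-c
`epi_of_forall_fieldPoint_app_top_surjective_of_isFiniteLocallyFree'`) concludes.
[cite: Mumford1966CurvesSurface, Lecture 15 (II.)] [cite: StacksProject, Tag 089R] -/
theorem epi_of_app_freeSectionOn_eq_monomialSection
    (ψ : freeModule T (Fin d → Fin (Nat.card ι + 1)) ⟶
      (Scheme.Modules.pushforward (i ≫ Morphisms.projectiveSpaceFst ι T)).obj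
        (SerreTwist.twistMod (i ≫ pullback.snd (terminal.from T) (terminal.from (Morphisms.projectiveSpaceInt ι)))
          (unitModule Z) d))
    (hψ : ∀ (w : Fin d → Fin (Nat.card ι + 1)) (V : T.Opens), ψ.app V (freeSectionOn T w V) =
      ((Scheme.Modules.pushforward (i ≫ Morphisms.projectiveSpaceFst ι T)).obj
        (SerreTwist.twistMod (i ≫ pullback.snd (terminal.from T) (terminal.from (Morphisms.projectiveSpaceInt ι)))
          (unitModule Z) d)).presheaf.map (homOfLE (le_top : V ≤ ⊤)).op
        (show Γ((Scheme.Modules.pushforward (i ≫ Morphisms.projectiveSpaceFst ι T)).obj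
          (SerreTwist.twistMod (i ≫ pullback.snd (terminal.from T) (terminal.from (Morphisms.projectiveSpaceInt ι)))
            (unitModule Z) d), ⊤) from
          SerreTwist.monomialSection (i ≫ pullback.snd (terminal.from T) (terminal.from (Morphisms.projectiveSpaceInt ι))) d w)) :
    Epi ψ := by
  classical
  have hQ := hasRank_pushforward_twistMod_of_hasRank_twists hn i P e₀ R hR hrk d k hk hd
  -- `ψ(ε_w) = μ_w|_Z` on global sections
  have hψtop : ∀ w : Fin d → Fin (Nat.card ι + 1), ψ.app ⊤ (freeSectionOn T w ⊤) =
      (show Γ((Scheme.Modules.pushforward (i ≫ Morphisms.projectiveSpaceFst ι T)).obj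
          (SerreTwist.twistMod (i ≫ pullback.snd (terminal.from T) (terminal.from (Morphisms.projectiveSpaceInt ι)))
            (unitModule Z) d), ⊤) from
        SerreTwist.monomialSection (i ≫ pullback.snd (terminal.from T) (terminal.from (Morphisms.projectiveSpaceInt ι))) d w) :=
    fun w => by
    rw [hψ w ⊤]
    have e1 : (homOfLE (le_top : (⊤ : T.Opens) ≤ ⊤)) = 𝟙 ⊤ := Subsingleton.elim _ _
    rw [e1, op_id, CategoryTheory.Functor.map_id]
    rfl
  refine epi_of_forall_fieldPoint_app_top_surjective_of_isFiniteLocallyFree' ψ (HasRank.isFiniteLocallyFree' hQ)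
    fun K _ x => ?_
  have Hsq : IsPullback (pullback.fst (i ≫ Morphisms.projectiveSpaceFst ι T) x)
      (pullback.snd (i ≫ Morphisms.projectiveSpaceFst ι T) x) (i ≫ Morphisms.projectiveSpaceFst ι T) x :=
    IsPullback.of_hasPullback _ x
  have letters := forall_fieldPoint_letters_of_hasRank_twists hn i P e₀ R hR hrk d k hk hd _ _ x Hsq
  haveI : IsIso (pushforwardBaseChangeHom Hsq.w
      (SerreTwist.twistMod (i ≫ pullback.snd (terminal.from T) (terminal.from (Morphisms.projectiveSpaceInt ι)))
        (unitModule Z) d)) :=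
    isIso_pushforwardBaseChangeHom_twistMod_of_forall_fieldPoint i d
      (fun _ _ _ kX f₀ x H => (forall_fieldPoint_letters_of_hasRank_twists hn i P e₀ R hR hrk d k hk hd kX f₀ x H).1) Hsq
  refine pullback_map_app_top_surjective_of_span Hsq _ ψ fun σ => ?_
  have hs := letters.2.2 σ
  have hfamj : (fun w : Fin d → Fin (Nat.card ι + 1) => SecMod.mk
        (L := (Scheme.Modules.pullback (pullback.fst (i ≫ Morphisms.projectiveSpaceFst ι T) x)).obj
          (SerreTwist.twistMod (i ≫ pullback.snd (terminal.from T) (terminal.from (Morphisms.projectiveSpaceInt ι)))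
            (unitModule Z) d)) (ρ := (pullback.snd (i ≫ Morphisms.projectiveSpaceFst ι T) x).appTop.hom) (U := ⊤)
        (unitSectionLE (pullback.fst (i ≫ Morphisms.projectiveSpaceFst ι T) x) _ (V := ⊤) (U := ⊤) le_top
          (ψ.app ⊤ (freeSectionOn T w ⊤)))) =
      fun w : Fin d → Fin (Nat.card ι + 1) => SecMod.mk
        (L := (Scheme.Modules.pullback (pullback.fst (i ≫ Morphisms.projectiveSpaceFst ι T) x)).obj
          (SerreTwist.twistMod (i ≫ pullback.snd (terminal.from T) (terminal.from (Morphisms.projectiveSpaceInt ι)))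
            (unitModule Z) d)) (ρ := (pullback.snd (i ≫ Morphisms.projectiveSpaceFst ι T) x).appTop.hom) (U := ⊤)
        (unitSectionLE (pullback.fst (i ≫ Morphisms.projectiveSpaceFst ι T) x) _ (V := ⊤) (U := ⊤) le_top
          (SerreTwist.monomialSection
            (i ≫ pullback.snd (terminal.from T) (terminal.from (Morphisms.projectiveSpaceInt ι))) d w)) :=
    funext fun w => by rw [hψtop]
  rw [hfamj]
  exact hs

end Exports


end Literature.AlgebraicGeometry.Motives

end
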